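import Summits.BirchSwinnertonDyer.BirchSwinnertonDyer.Theorems.SemiOrdinaryEisensteinDescentWildSigmaDivisibilityAtThreeMultiCarrierManinOfClassCertificate
import Summits.BirchSwinnertonDyer.BirchSwinnertonDyer.Theorems.SemiOrdinaryEisensteinDescentJetchevMaxDivisibilityAtThreeModThreeOfMiddleExact
import HarnessLib

/-!
# Crux J‴ `WildSigmaDivisibilityAtThreeMultiCarrier` (stmt-BirchSwinnertonDyer-25898), line `birth`: J‴'s conclusion ON CREMONA'S RANGE
# `N ≤ 500000` (⊇ every census class of row 2·3@3) from `stub_flatMultiCarrier` + PRINT ALONE — the Manin stub is GONE there;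
# and the POINTWISE form of the datum-scaling step (route `SemiOrdinaryEisensteinDescent`; width seat `bsd-wall-soed-p2-w2` g7;
# `--supports stmt-BirchSwinnertonDyer-25898`, helper)

WHY. The skeleton of record (`Cruxes/WildSigmaDivisibilityAtThreeMultiCarrier/Lines/birth.lean`, 223b1f81) composes J‴ from
`stub_flatMultiCarrier` (research), `stub_maninGood` (the `3`-part of Manin's conjecture for the class) and `stub_printConj`, through
GLOBAL statements (`∀ W` of the cell). Part 1 of this seat (`…ManinOfClassCertificate`) identified `stub_maninGood` with the class-local
Manin predicate and discharged it PER CURVE on Cremona's range from the named PRINT fact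
`cremona_abs_maninConstant_eq_one_of_level_le_500000` with no modularity fact. To cash that in one needs the composition POINTWISE in the
curve: this file re-runs w2 g5's datum-scaling step (`WildSigmaDivisibilityAtThreeTowerFreeOfFlatOfManinScaling` §1, whose proof is
already pointwise) at ONE frame with ONE scaled companion datum, and concludes.

WHAT IS PROVED (theorems only; no definition, no named fact, no `sorry`; CONDITIONAL on displayed hypotheses):
* §1 `sigma_at_of_sigmaFlat_of_scaledDatum` — at a fixed frame `(W, K, Dt, H, ι, P)` of the cell: if J′♭ holds (σ-divisibility to depth
  `ord₃ ∏ c_q` on every datum with `3 ∤ c`, all frames — the OUTPUT of w2 g5's `sigmaFlat_of_threePrintFacts_of_flatMultiCarrier` from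
  PT_conj + E0 + 3.7 (2) + `stub_flatMultiCarrier`) and `Dt` has a companion datum `Dt′` with the same newform and uniformisation,
  `Dt.c = k · Dt′.c`, `3 ∤ Dt′.c`, then the Kolyvagin points of `Dt` are `3`-divisible to the full depth `ord₃ ∏ c_q + v₃ c(Dt)` (J′'s
  conclusion at this frame): `P = k·P′`, `P(n) = k·P′(n)` (`exists_scaled_kolyvaginHeegnerData`; Darmon Thm. 3.6 PROVED), and at
  depth `s′` either `3^{s′} ∣ k` or J′♭ at depth `s′ − v₃ k` on `Dt′` — adapted verbatim from the global proof.
* §2 `sigma_at_of_threePrintFacts_of_flatMultiCarrier_of_level_le_500000` — **for every curve of the onto wild `r = 1` cell of conductor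
  `N ≤ 500000`, every admissible `K`, datum, Heegner datum and non-torsion `P`: J′'s (hence J‴'s) conclusion ⟸ PT_conj + E0 + 3.7 (2)
  + Cremona's sentence + `stub_flatMultiCarrier`** — NO Manin hypothesis, NO modularity fact (the companion datum is part 1's
  `primitiveAdmissible_of_level_le_500000` + `exists_datum_of_admissible`). `…_of_middleExact_…`: the same with the duality input = `hE`
  (Milne I 4.10(b) for THE maps; w2 g6). `…_of_classAbsManinConstantEqOne`: the same pointwise conclusion for ANY conductor under the
  class predicate `ClassAbsManinConstantEqOne W` of THIS curve only (not of the whole cell).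
NET (numbers, census currency): on the 3 413 JET-PRODUCT classes of row 2·3@3 (all of conductor `< 500000`) the line's research content
is `stub_flatMultiCarrier` ALONE modulo {PT_conj | hE, E0, 3.7 (2), Cremona}; the Manin stub matters only off Cremona's range, where it is
the conjecture leaf `ManinConstantOne` for the class (part 1). HONEST FRAMING: nothing here proves J‴, Manin's conjecture or a case of BSD;
every conclusion is conditional on the displayed research statement `hJmF` and named facts. BSD is not proved by any of this.

References: [Jetchev2008] Rem. 1.2, Thm. 1.4, Conj. 1.3 (p. 812); [Buyukboduk2009TamagawaDefect] §4.2 Q1; [CesnaviciusNeururerSaha2023]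
§1 p. 574 and [Cre22]; [Cremona2022ManinConstants]; [EdixhovenManin1991] §1; [Darmon2004] Thm. 3.6; [MilneADT2006] I Thm. 4.10(b);
[GrossLMS1991] Prop. 3.7 (2), §6.
-/

set_option autoImplicit false
set_option linter.dupNamespace false -- `Summit.BirchSwinnertonDyer.BirchSwinnertonDyer.…` is the tree's layout (D-0017)

noncomputable section

open scoped Classical

namespace Summit.BirchSwinnertonDyer.BirchSwinnertonDyer.Theorems.WildSigmaDivisibilityAtThreeMultiCarrierCremonaRange

open WeierstrassCurve NumberField IsDedekindDomain Literature.NumberTheory.EllipticCurves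
  Literature.NumberTheory.EllipticCurves.ModularForms
  Literature.NumberTheory.GaloisRepresentations Literature.NumberTheory.GaloisCohomology
  Summit.BirchSwinnertonDyer.Rank1Residual
  Summit.BirchSwinnertonDyer.Rank1Residual.Additive
  Summit.BirchSwinnertonDyer.Rank1Residual.X11b.Three
  Summit.BirchSwinnertonDyer.BirchSwinnertonDyer.Theses.SemiOrdinaryEisensteinDescent
  Summit.BirchSwinnertonDyer.BirchSwinnertonDyer.Theorems.WildSigmaDivisibilityAtThreeOfFlatOfManinScaling
  Summit.BirchSwinnertonDyer.BirchSwinnertonDyer.Theorems.WildKolyvaginUpperAtThreeTowerFreeJetchevMaxModThree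
  Summit.BirchSwinnertonDyer.BirchSwinnertonDyer.Theorems.WildKolyvaginUpperAtThreeTowerFreeManinPrimitive
  Summit.BirchSwinnertonDyer.BirchSwinnertonDyer.Theorems.WildSigmaDivisibilityAtThreeMultiCarrierManinOfClassCertificate
  Summit.BirchSwinnertonDyer.BirchSwinnertonDyer.Theorems.JetchevMaxDivisibilityAtThreeModThreeOfMiddleExact
open Literature.NumberTheory.GaloisRepresentations.DiscreteGaloisModule (localTatePairingZMod unramifiedSubgroup)
open Literature.NumberTheory.EllipticCurves.GrossLMS1991 (prop37_2_frobeniusCongruence)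

/-! ## §1 The datum-scaling step at ONE frame with ONE companion datum -/

/-- **σ-divisibility to the full depth at one frame ⟸ J′♭ (global) + one scaled companion datum.** Fix a frame of the cell:
`W` (ClassO6 at `3`, `ρ̄₃` onto, `r_an = 1`, conductor `N`), an admissible `K` (imaginary quadratic, Heegner hypothesis, `d_K` odd
`≠ −3`, `L(E^{d_K},1) ≠ 0`), a datum `Dt`, a Heegner datum `H`, `ι`, and the non-torsion point `P ↦ y_K(Dt)`. Suppose J′♭ (`hFlat`:
σ-divisibility to depth `ord₃ ∏ c_q` on every frame whose datum has `3 ∤ c`) and that `Dt` has a companion `Dt′` with `Dt′.f = Dt.f`,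
`Dt′.uniformize = Dt.uniformize`, `Dt.c = k · Dt′.c`, `3 ∤ Dt′.c`. Then for every `s′ ≤ ord₃ ∏ c_q + v₃ c(Dt)` and every square-free
Kolyvagin `n` with indices `≥ s′`, `3^{s′} ∣ P(n)` in `E(K[n])`: `P = k·P′` with `P′ ↦ y_K(Dt′)` (Darmon Thm. 3.6,
`heegnerPointComplex_mem_range_map_holds`), `P(n) = k·P′(n)` (`exists_scaled_kolyvaginHeegnerData`), and either `3^{s′} ∣ k` or J′♭ at
depth `s′ − v₃ k` on `Dt′`. Pointwise form of w2 g5's `wildSigmaDivisibilityAtThreeTowerFree_of_flat_of_maninScaling` (same proof).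
[cite: Jetchev2008, Rem. 1.2 and Conj. 1.3 (p. 812)] [cite: Darmon2004, Thm. 3.6] -/
theorem sigma_at_of_sigmaFlat_of_scaledDatum
    (hFlat : ∀ (W : WeierstrassCurve ℚ) [W.IsElliptic] [W.IsGloballyMinimal] (N : ℕ) [NeZero N] (K : Type)
      [Field K] [NumberField K] (Dt : ModularParametrizationData W N)
      (H : HeegnerDatum N (NumberField.discr K)) (ι : K →+* ℂ) (P : (W.baseChange K).toAffine.Point),
      ClassO6 W 3 → W.HasSurjectiveModNGaloisRep 3 → W.analyticRank = 1 → W.conductorNorm ℤ = N →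
      IsImaginaryQuadratic K → SatisfiesHeegnerHypothesis N K →
      (W.quadraticTwist (NumberField.discr K : ℚ)).entireLFunction 1 ≠ 0 →
      WeierstrassCurve.Affine.Point.map ι.toRatAlgHom P = heegnerPointComplex Dt H →
      ¬ IsOfFinAddOrder P → Odd (NumberField.discr K) → NumberField.discr K ≠ -3 →
      ¬ (3 : ℤ) ∣ Dt.c →
      ∀ (s' : ℕ), s' ≤ padicValNat 3 W.tamagawaProduct + padicValNat 3 Dt.c.natAbs →
        ∀ (n : ℕ) (d : KolyvaginHeegnerData Dt H.β ι n), Squarefree n →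
          (∀ ℓ ∈ n.primeFactors, Zhang2014.IsKolyvaginPrime N W K 3 ℓ ∧
            s' ≤ Zhang2014.kolyvaginIndex W 3 ℓ) → Koly.PDiv d 3 s')
    (W : WeierstrassCurve ℚ) [W.IsElliptic] [W.IsGloballyMinimal] (N : ℕ) [NeZero N] (K : Type)
    [Field K] [NumberField K] (Dt : ModularParametrizationData W N)
    (H : HeegnerDatum N (NumberField.discr K)) (ι : K →+* ℂ) (P : (W.baseChange K).toAffine.Point)
    (hO6 : ClassO6 W 3) (hsurj : W.HasSurjectiveModNGaloisRep 3) (hr : W.analyticRank = 1) (hN : W.conductorNorm ℤ = N)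
    (hK : IsImaginaryQuadratic K) (hHH : SatisfiesHeegnerHypothesis N K)
    (hL : (W.quadraticTwist (NumberField.discr K : ℚ)).entireLFunction 1 ≠ 0)
    (hP : WeierstrassCurve.Affine.Point.map ι.toRatAlgHom P = heegnerPointComplex Dt H)
    (hnt : ¬ IsOfFinAddOrder P) (hodd : Odd (NumberField.discr K)) (h3 : NumberField.discr K ≠ -3)
    (hScalW : ∃ (Dt' : ModularParametrizationData W N) (k : ℤ),
      Dt'.f = Dt.f ∧ Dt'.uniformize = Dt.uniformize ∧ Dt.c = k * Dt'.c ∧ ¬ (3 : ℤ) ∣ Dt'.c) :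
    ∀ (s' : ℕ), s' ≤ padicValNat 3 W.tamagawaProduct + padicValNat 3 Dt.c.natAbs →
      ∀ (n : ℕ) (d : KolyvaginHeegnerData Dt H.β ι n), Squarefree n →
        (∀ ℓ ∈ n.primeFactors, Zhang2014.IsKolyvaginPrime N W K 3 ℓ ∧
          s' ≤ Zhang2014.kolyvaginIndex W 3 ℓ) → Koly.PDiv d 3 s' := by
  -- adapted from `…WildSigmaDivisibilityAtThreeTowerFreeOfFlatOfManinScaling` §1 (w2 g5), at one frame
  intro s' hs' n d hn hℓ
  haveI : Fact (Nat.Prime 3) := ⟨Nat.prime_three⟩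
  obtain ⟨Dt', k, hf, hu, hc, hc'⟩ := hScalW
  -- the `K`-rational Heegner point of `Dt′` (Darmon Thm. 3.6, PROVED) and `P = k·P′`
  obtain ⟨P', hP'⟩ := heegnerPointComplex_mem_range_map_holds N W K hK hHH Dt' H ι
  have hPk : P = k • P' := by
    apply WeierstrassCurve.Affine.Point.map_injective (W' := W) ι.toRatAlgHom
    rw [map_zsmul, hP, hP', heegnerPointComplex_eq_zsmul_of_scaling hf hu hc]
  have hnt' : ¬ IsOfFinAddOrder P' := fun h ↦ hnt (hPk ▸ h.zsmul)
  have hk0 : k ≠ 0 := by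
    rintro rfl
    exact hnt (by rw [hPk, zero_smul]; exact IsOfFinAddOrder.zero)
  -- `v₃(c(Dt)) = v₃(k)`
  set v := padicValNat 3 k.natAbs with hv
  have hc'0 : Dt'.c ≠ 0 := by rintro h; exact hc' (h ▸ dvd_zero 3)
  have hvc : padicValNat 3 Dt.c.natAbs = v := by
    rw [hc, Int.natAbs_mul, padicValNat.mul (Int.natAbs_ne_zero.mpr hk0) (Int.natAbs_ne_zero.mpr hc'0),
      padicValNat.eq_zero_of_not_dvd (fun h ↦ hc' (Int.natCast_dvd.mpr h)), add_zero]
  -- `3^v ∣ k`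
  obtain ⟨m, hm⟩ : ((3 ^ v : ℕ) : ℤ) ∣ k := Int.natCast_dvd.mpr pow_padicValNat_dvd
  -- the companion datum `d′` with `P(n) = k·P′(n)`
  have hn0 : n ≠ 0 := hn.ne_zero
  have hcop : Nat.Coprime n N := Nat.coprime_of_dvd fun q hq hqn hqN ↦
    (hℓ q (Nat.mem_primeFactors.mpr ⟨hq, hqn, hn0⟩)).1.2.1 hqN
  obtain ⟨d', hd'⟩ := exists_scaled_kolyvaginHeegnerData hK hHH hf hu hc hn0 hcop d
  by_cases hsv : s' ≤ v
  · -- free: `3^{s′} ∣ k`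
    obtain ⟨m', hm'⟩ : ((3 ^ s' : ℕ) : ℤ) ∣ k :=
      (Int.natCast_dvd_natCast.mpr (pow_dvd_pow 3 hsv)).trans ⟨m, hm⟩
    exact ⟨m' • d'.derivedPoint, by rw [← mul_smul, ← hm', hd']⟩
  · -- J′♭ at depth `s′ − v ≤ ord₃ ∏ c_ℓ` on `d′`
    push Not at hsv
    have hb : s' - v ≤ padicValNat 3 W.tamagawaProduct + padicValNat 3 Dt'.c.natAbs := by omega
    have hℓ' : ∀ ℓ ∈ n.primeFactors, Zhang2014.IsKolyvaginPrime N W K 3 ℓ ∧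
        s' - v ≤ Zhang2014.kolyvaginIndex W 3 ℓ := fun ℓ hℓn ↦
      ⟨(hℓ ℓ hℓn).1, le_trans (Nat.sub_le _ _) (hℓ ℓ hℓn).2⟩
    obtain ⟨Q', hQ'⟩ := hFlat W N K Dt' H ι P' hO6 hsurj hr hN hK hHH hL hP' hnt' hodd h3 hc' (s' - v) hb
      n d' hn hℓ'
    refine ⟨m • Q', ?_⟩
    have hpow : ((3 ^ s' : ℕ) : ℤ) * m = k * ((3 ^ (s' - v) : ℕ) : ℤ) := by
      have h3 : (3 : ℤ) ^ s' = 3 ^ v * 3 ^ (s' - v) := by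
        rw [← pow_add, Nat.add_sub_cancel' hsv.le]
      rw [hm]; push_cast
      rw [h3]; ring
    rw [← mul_smul, hpow, mul_smul, hQ', hd']

/-- **A scaled companion datum from an admissible `3`-primitive part** (part 1's `primitiveAdmissible…` shape ⟹ the `hScalW` shape of
§1): if `Dt.c = k·c₁` with `3 ∤ c₁` and `c₁ Λ_f ⊆ Λ_W`, then some `Dt′` has the same newform and uniformisation, `Dt.c = k·Dt′.c` and
`3 ∤ Dt′.c` (w2 g5's `exists_datum_of_admissible`: the degree of `Γ₀(N)τ ↦ c₁·2πi∫f` is the PROVED `exists_modularDegree_holds`).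
[cite: EdixhovenManin1991, §1] [cite: DiamondShurman2005, §6.6] -/
theorem exists_scaledDatum_of_primitiveAdmissible {W : WeierstrassCurve ℚ} {N : ℕ} [NeZero N]
    (Dt : ModularParametrizationData W N)
    (h : ∃ (c₁ k : ℤ), Dt.c = k * c₁ ∧ ¬ (3 : ℤ) ∣ c₁ ∧ ∀ z ∈ periodLattice Dt.f, (c₁ : ℂ) * z ∈ Dt.L.lattice) :
    ∃ (Dt' : ModularParametrizationData W N) (k : ℤ),
      Dt'.f = Dt.f ∧ Dt'.uniformize = Dt.uniformize ∧ Dt.c = k * Dt'.c ∧ ¬ (3 : ℤ) ∣ Dt'.c := by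
  obtain ⟨c₁, k, hck, h3, hadm⟩ := h
  have hc₁ : c₁ ≠ 0 := by rintro rfl; exact h3 (dvd_zero 3)
  obtain ⟨Dt', hf, hu, hc⟩ := exists_datum_of_admissible Dt hc₁ hadm
  exact ⟨Dt', k, hf, hu, by rw [hc, hck], by rw [hc]; exact h3⟩

/-! ## §2 J‴'s conclusion on Cremona's range from `stub_flatMultiCarrier` + PRINT alone (pointwise; no Manin hypothesis) -/

/-- **J′'s (hence J‴'s) conclusion at every frame of conductor `N ≤ 500000` ⟸ PT_conj + E0 + 3.7 (2) + Cremona's sentence +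
`stub_flatMultiCarrier`.** For `W` on the onto wild `r = 1` cell with conductor `N ≤ 500000` (this contains every census class of row
2·3@3), admissible `K`, datum `Dt`, Heegner datum `H`, `ι`, non-torsion `P ↦ y_K`: the Kolyvagin points are `3`-divisible to the full
depth `ord₃ ∏ c_q + v₃ c(Dt)`. Proof: J′♭ on all frames from the three print facts + `hJmF` (w2 g5's
`sigmaFlat_of_threePrintFacts_of_flatMultiCarrier`: Jetchev's max-form mod `3` on single-carrier depths, `hJmF` beyond); the companion
datum from part 1's `primitiveAdmissible_of_level_le_500000` (optimal curve of the class + Cremona's `|c₀| = 1` at level `N ≤ 500000` +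
Néron multiplier prime to `3` + Bézout; NO modularity fact, `E[3]` irreducible from `ρ̄₃` onto); then §1. CONDITIONAL on the four named
facts and the research statement `hJmF` (= `stub_flatMultiCarrier` verbatim); nothing is asserted about any curve unconditionally.
[cite: Jetchev2008, Thm. 1.4 and Conj. 1.3 (p. 812)] [cite: Buyukboduk2009TamagawaDefect, §4.2 Question 1]
[cite: CesnaviciusNeururerSaha2023, §1 p. 574 and ref. [Cre22]] [cite: GrossLMS1991, Prop. 3.7 (2) and §6] -/
theorem sigma_at_of_threePrintFacts_of_flatMultiCarrier_of_level_le_500000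
    (hPT : ∀ (K : Type) [Field K] [NumberField K], poitouTate_selmerStructure_duality_conj K)
    (hE0 : Gross1991_heegnerPoint_sub_ratTorsion_mem_E0) (h372 : prop37_2_frobeniusCongruence)
    (h500 : cremona_abs_maninConstant_eq_one_of_level_le_500000)
    (hJmF : ∀ (W : WeierstrassCurve ℚ) [W.IsElliptic] [W.IsGloballyMinimal] (N : ℕ) [NeZero N] (K : Type)
      [Field K] [NumberField K] (Dt : ModularParametrizationData W N)
      (H : HeegnerDatum N (NumberField.discr K)) (ι : K →+* ℂ) (P : (W.baseChange K).toAffine.Point),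
      ClassO6 W 3 → W.HasSurjectiveModNGaloisRep 3 → W.analyticRank = 1 → W.conductorNorm ℤ = N →
      IsImaginaryQuadratic K → SatisfiesHeegnerHypothesis N K →
      (W.quadraticTwist (NumberField.discr K : ℚ)).entireLFunction 1 ≠ 0 →
      WeierstrassCurve.Affine.Point.map ι.toRatAlgHom P = heegnerPointComplex Dt H →
      ¬ IsOfFinAddOrder P → Odd (NumberField.discr K) → NumberField.discr K ≠ -3 →
      ¬ (3 : ℤ) ∣ Dt.c →
      (∀ (q : ℕ) [Fact q.Prime], q ∣ N →
        padicValNat 3 ((W.baseChange ℚ_[q]).localTamagawaNumber ℤ_[q]) <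
          padicValNat 3 W.tamagawaProduct + padicValNat 3 Dt.c.natAbs) →
      ∀ (s' : ℕ), s' ≤ padicValNat 3 W.tamagawaProduct + padicValNat 3 Dt.c.natAbs →
        ∀ (n : ℕ) (d : KolyvaginHeegnerData Dt H.β ι n), Squarefree n →
          (∀ ℓ ∈ n.primeFactors, Zhang2014.IsKolyvaginPrime N W K 3 ℓ ∧
            s' ≤ Zhang2014.kolyvaginIndex W 3 ℓ) → Koly.PDiv d 3 s')
    (W : WeierstrassCurve ℚ) [W.IsElliptic] [W.IsGloballyMinimal] (N : ℕ) [NeZero N] (K : Type)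
    [Field K] [NumberField K] (Dt : ModularParametrizationData W N)
    (H : HeegnerDatum N (NumberField.discr K)) (ι : K →+* ℂ) (P : (W.baseChange K).toAffine.Point)
    (hO6 : ClassO6 W 3) (hsurj : W.HasSurjectiveModNGaloisRep 3) (hr : W.analyticRank = 1) (hN : W.conductorNorm ℤ = N)
    (hK : IsImaginaryQuadratic K) (hHH : SatisfiesHeegnerHypothesis N K)
    (hL : (W.quadraticTwist (NumberField.discr K : ℚ)).entireLFunction 1 ≠ 0)
    (hP : WeierstrassCurve.Affine.Point.map ι.toRatAlgHom P = heegnerPointComplex Dt H)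
    (hnt : ¬ IsOfFinAddOrder P) (hodd : Odd (NumberField.discr K)) (h3 : NumberField.discr K ≠ -3)
    (hN500 : N ≤ 500000) :
    ∀ (s' : ℕ), s' ≤ padicValNat 3 W.tamagawaProduct + padicValNat 3 Dt.c.natAbs →
      ∀ (n : ℕ) (d : KolyvaginHeegnerData Dt H.β ι n), Squarefree n →
        (∀ ℓ ∈ n.primeFactors, Zhang2014.IsKolyvaginPrime N W K 3 ℓ ∧
          s' ≤ Zhang2014.kolyvaginIndex W 3 ℓ) → Koly.PDiv d 3 s' := by
  haveI : Fact (Nat.Prime 3) := ⟨Nat.prime_three⟩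
  have hirr : W.HasIrreducibleModPGaloisRep 3 :=
    hasIrreducibleModPGaloisRep_of_hasSurjectiveModNGaloisRep W 3 (by exact_mod_cast hsurj)
  exact sigma_at_of_sigmaFlat_of_scaledDatum (sigmaFlat_of_threePrintFacts_of_flatMultiCarrier hPT hE0 h372 hJmF)
    W N K Dt H ι P hO6 hsurj hr hN hK hHH hL hP hnt hodd h3
    (exists_scaledDatum_of_primitiveAdmissible Dt (primitiveAdmissible_of_level_le_500000 h500 hN hN500 hirr Dt))

/-- **The same with the duality input = `hE`** (Milne I Thm. 4.10(b) `Ker γ¹ ⊆ Im β¹` for THE canonical maps, every `K`, `n`; PT_conj from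
it by w2 g6's `poitouTate_conj_forall_of_middleExact_canonical`). So on Cremona's range the frame-wise inputs of the Kolyvagin column's
research crux are {`hE`, E0, 3.7 (2), Cremona} ⊕ `stub_flatMultiCarrier`. CONDITIONAL; nothing asserted.
[cite: MilneADT2006, Ch. I, Thm. 4.10(b)] [cite: Jetchev2008, Thm. 1.4 and Conj. 1.3 (p. 812)]
[cite: CesnaviciusNeururerSaha2023, §1 p. 574 and ref. [Cre22]] -/
theorem sigma_at_of_middleExact_of_flatMultiCarrier_of_level_le_500000
    (hE : ∀ (K : Type) [Field K] [NumberField K] (n : ℕ) [NeZero n],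
      ∀ ⦃M : Type⦄ [AddCommGroup M] [TopologicalSpace M] [DiscreteTopology M] [Finite M]
      (ρ : DiscreteGaloisModule K M), (∀ m : M, n • m = 0) →
      ∀ S : Finset (Place K), (∀ w : InfinitePlace K, (Sum.inl w : Place K) ∈ S) →
        (∀ v : HeightOneSpectrum (𝓞 K), (Sum.inr v : Place K) ∉ S →
          ((n : ℕ) : 𝓞 K) ∉ v.asIdeal ∧ GaloisRep.IsUnramifiedAt v ρ) →
        ∀ t : Π v : Place K, galoisCohomology (ρ.toLocal v) 1,
          (∀ y : galoisCohomology (ρ.tateDual n) 1,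
            (∀ v : HeightOneSpectrum (𝓞 K), (Sum.inr v : Place K) ∉ S →
              galoisCohomology.localization (ρ.tateDual n) (Sum.inr v) 1 y ∈
                unramifiedSubgroup (GaloisRep.toLocal v (ρ.tateDual n)) 1) →
            ∑ v ∈ S, localTatePairingZMod ρ n v (LocalInvariants.canonical K n v) (t v)
              (galoisCohomology.localization (ρ.tateDual n) v 1 y) = 0) →
          ∃ x : galoisCohomology ρ 1,
            (∀ v : HeightOneSpectrum (𝓞 K), (Sum.inr v : Place K) ∉ S →
              galoisCohomology.localization ρ (Sum.inr v) 1 x ∈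
                unramifiedSubgroup (GaloisRep.toLocal v ρ) 1) ∧
            ∀ v ∈ S, galoisCohomology.localization ρ v 1 x = t v)
    (hE0 : Gross1991_heegnerPoint_sub_ratTorsion_mem_E0) (h372 : prop37_2_frobeniusCongruence)
    (h500 : cremona_abs_maninConstant_eq_one_of_level_le_500000)
    (hJmF : ∀ (W : WeierstrassCurve ℚ) [W.IsElliptic] [W.IsGloballyMinimal] (N : ℕ) [NeZero N] (K : Type)
      [Field K] [NumberField K] (Dt : ModularParametrizationData W N)
      (H : HeegnerDatum N (NumberField.discr K)) (ι : K →+* ℂ) (P : (W.baseChange K).toAffine.Point),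
      ClassO6 W 3 → W.HasSurjectiveModNGaloisRep 3 → W.analyticRank = 1 → W.conductorNorm ℤ = N →
      IsImaginaryQuadratic K → SatisfiesHeegnerHypothesis N K →
      (W.quadraticTwist (NumberField.discr K : ℚ)).entireLFunction 1 ≠ 0 →
      WeierstrassCurve.Affine.Point.map ι.toRatAlgHom P = heegnerPointComplex Dt H →
      ¬ IsOfFinAddOrder P → Odd (NumberField.discr K) → NumberField.discr K ≠ -3 →
      ¬ (3 : ℤ) ∣ Dt.c →
      (∀ (q : ℕ) [Fact q.Prime], q ∣ N →
        padicValNat 3 ((W.baseChange ℚ_[q]).localTamagawaNumber ℤ_[q]) <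
          padicValNat 3 W.tamagawaProduct + padicValNat 3 Dt.c.natAbs) →
      ∀ (s' : ℕ), s' ≤ padicValNat 3 W.tamagawaProduct + padicValNat 3 Dt.c.natAbs →
        ∀ (n : ℕ) (d : KolyvaginHeegnerData Dt H.β ι n), Squarefree n →
          (∀ ℓ ∈ n.primeFactors, Zhang2014.IsKolyvaginPrime N W K 3 ℓ ∧
            s' ≤ Zhang2014.kolyvaginIndex W 3 ℓ) → Koly.PDiv d 3 s')
    (W : WeierstrassCurve ℚ) [W.IsElliptic] [W.IsGloballyMinimal] (N : ℕ) [NeZero N] (K : Type)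
    [Field K] [NumberField K] (Dt : ModularParametrizationData W N)
    (H : HeegnerDatum N (NumberField.discr K)) (ι : K →+* ℂ) (P : (W.baseChange K).toAffine.Point)
    (hO6 : ClassO6 W 3) (hsurj : W.HasSurjectiveModNGaloisRep 3) (hr : W.analyticRank = 1) (hN : W.conductorNorm ℤ = N)
    (hK : IsImaginaryQuadratic K) (hHH : SatisfiesHeegnerHypothesis N K)
    (hL : (W.quadraticTwist (NumberField.discr K : ℚ)).entireLFunction 1 ≠ 0)
    (hP : WeierstrassCurve.Affine.Point.map ι.toRatAlgHom P = heegnerPointComplex Dt H)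
    (hnt : ¬ IsOfFinAddOrder P) (hodd : Odd (NumberField.discr K)) (h3 : NumberField.discr K ≠ -3)
    (hN500 : N ≤ 500000) :
    ∀ (s' : ℕ), s' ≤ padicValNat 3 W.tamagawaProduct + padicValNat 3 Dt.c.natAbs →
      ∀ (n : ℕ) (d : KolyvaginHeegnerData Dt H.β ι n), Squarefree n →
        (∀ ℓ ∈ n.primeFactors, Zhang2014.IsKolyvaginPrime N W K 3 ℓ ∧
          s' ≤ Zhang2014.kolyvaginIndex W 3 ℓ) → Koly.PDiv d 3 s' :=
  sigma_at_of_threePrintFacts_of_flatMultiCarrier_of_level_le_500000 (poitouTate_conj_forall_of_middleExact_canonical hE)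
    hE0 h372 h500 hJmF W N K Dt H ι P hO6 hsurj hr hN hK hHH hL hP hnt hodd h3 hN500

/-- **Any conductor, class predicate of THIS curve only**: J′'s conclusion at a frame of the cell ⟸ PT_conj + E0 + 3.7 (2) +
`stub_flatMultiCarrier` + `ClassAbsManinConstantEqOne W` (Manin's conjecture for the class of `W` alone — not for the whole cell, as
the global composition of part 1 §3 needs). CONDITIONAL; nothing asserted. [cite: AgasheRibetStein2006, §2 and Thm. 2.7]
[cite: Jetchev2008, Thm. 1.4 and Conj. 1.3 (p. 812)] [cite: Buyukboduk2009TamagawaDefect, §4.2 Question 1] -/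
theorem sigma_at_of_threePrintFacts_of_flatMultiCarrier_of_classAbsManinConstantEqOne
    (hPT : ∀ (K : Type) [Field K] [NumberField K], poitouTate_selmerStructure_duality_conj K)
    (hE0 : Gross1991_heegnerPoint_sub_ratTorsion_mem_E0) (h372 : prop37_2_frobeniusCongruence)
    (hJmF : ∀ (W : WeierstrassCurve ℚ) [W.IsElliptic] [W.IsGloballyMinimal] (N : ℕ) [NeZero N] (K : Type)
      [Field K] [NumberField K] (Dt : ModularParametrizationData W N)
      (H : HeegnerDatum N (NumberField.discr K)) (ι : K →+* ℂ) (P : (W.baseChange K).toAffine.Point),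
      ClassO6 W 3 → W.HasSurjectiveModNGaloisRep 3 → W.analyticRank = 1 → W.conductorNorm ℤ = N →
      IsImaginaryQuadratic K → SatisfiesHeegnerHypothesis N K →
      (W.quadraticTwist (NumberField.discr K : ℚ)).entireLFunction 1 ≠ 0 →
      WeierstrassCurve.Affine.Point.map ι.toRatAlgHom P = heegnerPointComplex Dt H →
      ¬ IsOfFinAddOrder P → Odd (NumberField.discr K) → NumberField.discr K ≠ -3 →
      ¬ (3 : ℤ) ∣ Dt.c →
      (∀ (q : ℕ) [Fact q.Prime], q ∣ N →
        padicValNat 3 ((W.baseChange ℚ_[q]).localTamagawaNumber ℤ_[q]) <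
          padicValNat 3 W.tamagawaProduct + padicValNat 3 Dt.c.natAbs) →
      ∀ (s' : ℕ), s' ≤ padicValNat 3 W.tamagawaProduct + padicValNat 3 Dt.c.natAbs →
        ∀ (n : ℕ) (d : KolyvaginHeegnerData Dt H.β ι n), Squarefree n →
          (∀ ℓ ∈ n.primeFactors, Zhang2014.IsKolyvaginPrime N W K 3 ℓ ∧
            s' ≤ Zhang2014.kolyvaginIndex W 3 ℓ) → Koly.PDiv d 3 s')
    (W : WeierstrassCurve ℚ) [W.IsElliptic] [W.IsGloballyMinimal] (N : ℕ) [NeZero N] (K : Type)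
    [Field K] [NumberField K] (Dt : ModularParametrizationData W N)
    (H : HeegnerDatum N (NumberField.discr K)) (ι : K →+* ℂ) (P : (W.baseChange K).toAffine.Point)
    (hO6 : ClassO6 W 3) (hsurj : W.HasSurjectiveModNGaloisRep 3) (hr : W.analyticRank = 1) (hN : W.conductorNorm ℤ = N)
    (hK : IsImaginaryQuadratic K) (hHH : SatisfiesHeegnerHypothesis N K)
    (hL : (W.quadraticTwist (NumberField.discr K : ℚ)).entireLFunction 1 ≠ 0)
    (hP : WeierstrassCurve.Affine.Point.map ι.toRatAlgHom P = heegnerPointComplex Dt H)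
    (hnt : ¬ IsOfFinAddOrder P) (hodd : Odd (NumberField.discr K)) (h3 : NumberField.discr K ≠ -3)
    (hMan : ClassAbsManinConstantEqOne W) :
    ∀ (s' : ℕ), s' ≤ padicValNat 3 W.tamagawaProduct + padicValNat 3 Dt.c.natAbs →
      ∀ (n : ℕ) (d : KolyvaginHeegnerData Dt H.β ι n), Squarefree n →
        (∀ ℓ ∈ n.primeFactors, Zhang2014.IsKolyvaginPrime N W K 3 ℓ ∧
          s' ≤ Zhang2014.kolyvaginIndex W 3 ℓ) → Koly.PDiv d 3 s' := by
  haveI : Fact (Nat.Prime 3) := ⟨Nat.prime_three⟩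
  have hirr : W.HasIrreducibleModPGaloisRep 3 :=
    hasIrreducibleModPGaloisRep_of_hasSurjectiveModNGaloisRep W 3 (by exact_mod_cast hsurj)
  -- a `3`-good companion datum of THIS curve from the class predicate of THIS curve (part 1 §1), then Bézout and §1
  obtain ⟨Dt₀, hf, hLt, h3c⟩ :=
    exists_modularParametrizationData_not_dvd_of_classAbsManinConstantEqOne hN Dt Nat.prime_three hirr hMan
  have hPrimW : ∃ (c₁ k : ℤ), Dt.c = k * c₁ ∧ ¬ (3 : ℤ) ∣ c₁ ∧ ∀ z ∈ periodLattice Dt.f, (c₁ : ℂ) * z ∈ Dt.L.lattice := by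
    refine ⟨(Int.gcd Dt.c Dt₀.c : ℤ), Dt.c / (Int.gcd Dt.c Dt₀.c : ℤ), ?_, ?_, ?_⟩
    · exact (Int.ediv_mul_cancel (Int.gcd_dvd_left Dt.c Dt₀.c)).symm
    · exact fun h ↦ h3c (h.trans (Int.gcd_dvd_right Dt.c Dt₀.c))
    · intro z hz
      have h1 : (Dt.c : ℂ) * z ∈ Dt.L.lattice := Dt.smul_periodLattice_le z hz
      have h2 : (Dt₀.c : ℂ) * z ∈ Dt.L.lattice := hLt ▸ Dt₀.smul_periodLattice_le z (hf ▸ hz)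
      have hB : ((Int.gcd Dt.c Dt₀.c : ℤ) : ℂ) * z =
          (Dt.c.gcdA Dt₀.c : ℂ) * ((Dt.c : ℂ) * z) + (Dt.c.gcdB Dt₀.c : ℂ) * ((Dt₀.c : ℂ) * z) := by
        rw [Int.gcd_eq_gcd_ab Dt.c Dt₀.c]; push_cast; ring
      have hmul : ∀ (a : ℤ) {x : ℂ}, x ∈ Dt.L.lattice → (a : ℂ) * x ∈ Dt.L.lattice := fun a x hx ↦ by
        rw [← zsmul_eq_mul]; exact Dt.L.lattice.smul_mem a hx
      rw [hB]
      exact Dt.L.lattice.add_mem (hmul _ h1) (hmul _ h2)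
  exact sigma_at_of_sigmaFlat_of_scaledDatum (sigmaFlat_of_threePrintFacts_of_flatMultiCarrier hPT hE0 h372 hJmF)
    W N K Dt H ι P hO6 hsurj hr hN hK hHH hL hP hnt hodd h3 (exists_scaledDatum_of_primitiveAdmissible Dt hPrimW)

/-! ## §3 The `3`-LOCAL Manin input («`3 ∤ c₀` at the optimal curve of the class») — the weakest text, in the lattice-clause
vocabulary of every Manin fact of the tree; `hGood` and J‴ BY NAME from it -/

/-- **`hGood` ⟸ Manin₃ at the optimal curve** (`hM3`: for every curve `W` of the cell and every lattice-optimal `X₀(N)`-datum `D₀` of a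
globally minimal `W₀ ∼ W` at the conductor level, `3 ∤ c(D₀)` — the `3`-part of Manin's conjecture for the class, shape of
`mazur_…`/`edixhoven_…`/`cremona_…`): part 1's `exists_modularParametrizationData_not_dvd_of_optimal_not_dvd` at `p = 3`.
[cite: AgasheRibetStein2006, §2 and Thm. 2.7] [cite: EdixhovenManin1991, §1] -/
theorem maninGood_of_optimalNotDvdThree
    (hM3 : ∀ (W : WeierstrassCurve ℚ) [W.IsElliptic] [W.IsGloballyMinimal] (N : ℕ) [NeZero N],
      ClassO6 W 3 → W.HasSurjectiveModNGaloisRep 3 → W.analyticRank = 1 → W.conductorNorm ℤ = N →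
      ∀ (W₀ : WeierstrassCurve ℚ) [W₀.IsElliptic] [W₀.IsGloballyMinimal] (D₀ : ModularParametrizationData W₀ N),
        W.IsIsogenous W₀ → (∀ z ∈ D₀.L.lattice, ∃ w ∈ periodLattice D₀.f, z = D₀.c * w) → ¬ (3 : ℤ) ∣ D₀.c) :
    ∀ (W : WeierstrassCurve ℚ) [W.IsElliptic] [W.IsGloballyMinimal] (N : ℕ) [NeZero N],
      ClassO6 W 3 → W.HasSurjectiveModNGaloisRep 3 → W.analyticRank = 1 → W.conductorNorm ℤ = N →
      Nonempty (ModularParametrizationData W N) →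
      ∃ Dt₀ : ModularParametrizationData W N, ¬ (3 : ℤ) ∣ Dt₀.c := by
  intro W _ _ N _ hO6 hsurj hr hN hD
  obtain ⟨Dt⟩ := hD
  haveI : Fact (Nat.Prime 3) := ⟨Nat.prime_three⟩
  have hirr : W.HasIrreducibleModPGaloisRep 3 :=
    hasIrreducibleModPGaloisRep_of_hasSurjectiveModNGaloisRep W 3 (by exact_mod_cast hsurj)
  obtain ⟨D, -, -, hD3⟩ := exists_modularParametrizationData_not_dvd_of_optimal_not_dvd hN Dt Nat.prime_three hirr
    (fun W₀ _ _ D₀ hiso hopt ↦ hM3 W N hO6 hsurj hr hN W₀ D₀ hiso hopt)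
  exact ⟨D, hD3⟩

/-- **J‴ (25898) BY NAME ⟸ PT_conj + E0 + 3.7 (2) + `stub_flatMultiCarrier` + Manin₃ at the optimal curve (`hM3`, the `3`-local text)**
— the composition used by skeleton v2 of line `birth`. CONDITIONAL; nothing asserted. [cite: Jetchev2008, Thm. 1.4 and Conj. 1.3 (p. 812)]
[cite: Buyukboduk2009TamagawaDefect, §4.2 Question 1] [cite: AgasheRibetStein2006, §2 and Thm. 2.7] -/
theorem wildSigmaDivisibilityAtThreeMultiCarrier_of_flatMultiCarrier_of_maninThree_of_threePrintFacts
    (hPT : ∀ (K : Type) [Field K] [NumberField K], poitouTate_selmerStructure_duality_conj K)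
    (hE0 : Gross1991_heegnerPoint_sub_ratTorsion_mem_E0) (h372 : prop37_2_frobeniusCongruence)
    (hM3 : ∀ (W : WeierstrassCurve ℚ) [W.IsElliptic] [W.IsGloballyMinimal] (N : ℕ) [NeZero N],
      ClassO6 W 3 → W.HasSurjectiveModNGaloisRep 3 → W.analyticRank = 1 → W.conductorNorm ℤ = N →
      ∀ (W₀ : WeierstrassCurve ℚ) [W₀.IsElliptic] [W₀.IsGloballyMinimal] (D₀ : ModularParametrizationData W₀ N),
        W.IsIsogenous W₀ → (∀ z ∈ D₀.L.lattice, ∃ w ∈ periodLattice D₀.f, z = D₀.c * w) → ¬ (3 : ℤ) ∣ D₀.c)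
    (hJmF : ∀ (W : WeierstrassCurve ℚ) [W.IsElliptic] [W.IsGloballyMinimal] (N : ℕ) [NeZero N] (K : Type)
      [Field K] [NumberField K] (Dt : ModularParametrizationData W N)
      (H : HeegnerDatum N (NumberField.discr K)) (ι : K →+* ℂ) (P : (W.baseChange K).toAffine.Point),
      ClassO6 W 3 → W.HasSurjectiveModNGaloisRep 3 → W.analyticRank = 1 → W.conductorNorm ℤ = N →
      IsImaginaryQuadratic K → SatisfiesHeegnerHypothesis N K →
      (W.quadraticTwist (NumberField.discr K : ℚ)).entireLFunction 1 ≠ 0 →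
      WeierstrassCurve.Affine.Point.map ι.toRatAlgHom P = heegnerPointComplex Dt H →
      ¬ IsOfFinAddOrder P → Odd (NumberField.discr K) → NumberField.discr K ≠ -3 →
      ¬ (3 : ℤ) ∣ Dt.c →
      (∀ (q : ℕ) [Fact q.Prime], q ∣ N →
        padicValNat 3 ((W.baseChange ℚ_[q]).localTamagawaNumber ℤ_[q]) <
          padicValNat 3 W.tamagawaProduct + padicValNat 3 Dt.c.natAbs) →
      ∀ (s' : ℕ), s' ≤ padicValNat 3 W.tamagawaProduct + padicValNat 3 Dt.c.natAbs →
        ∀ (n : ℕ) (d : KolyvaginHeegnerData Dt H.β ι n), Squarefree n →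
          (∀ ℓ ∈ n.primeFactors, Zhang2014.IsKolyvaginPrime N W K 3 ℓ ∧
            s' ≤ Zhang2014.kolyvaginIndex W 3 ℓ) → Koly.PDiv d 3 s') :
    WildSigmaDivisibilityAtThreeMultiCarrier :=
  WildSigmaDivisibilityAtThreeMultiCarrierOfMiddleExact.wildSigmaDivisibilityAtThreeMultiCarrier_of_towerFree
    (wildSigmaDivisibilityAtThreeTowerFree_of_flatMultiCarrier_of_primitiveAdmissible_of_threePrintFacts hPT hE0 h372
      (primitiveAdmissible_of_maninGood (maninGood_of_optimalNotDvdThree hM3)) hJmF)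

end Summit.BirchSwinnertonDyer.BirchSwinnertonDyer.Theorems.WildSigmaDivisibilityAtThreeMultiCarrierCremonaRange

end
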